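import Literature.Analysis.Calculus.IteratedFDerivParametricIntegral   -- ★ `iteratedFDeriv_integral_eq`, `contDiff_integral_of_dominated_iteratedFDeriv` (Hörmander 1.1.9, dominated form)
import Literature.Analysis.Calculus.ContDiffCurryCompact               -- ★ (CURRY-∞) p850802: `contDiff_curry_infty_of_forall_apply_eq`, `iteratedFDeriv_curry_apply_infty_of_forall_apply_eq`, `hasCompactSupport_curry_of_forall_apply_eq`
import Mathlib.MeasureTheory.Integral.Bochner.Set                      -- `continuousOn_integral_of_compact_support` (no countability hypothesis on the parameter space)
import Literature.Analysis.FunctionSpaces.SmoothParametricIntegralDominated  -- ★ `contDiffOn_integral_of_dominated`, `iteratedFDeriv_integral_of_dominated` (open parameter set, LOCAL domination) — ED. 2 §4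
import HarnessLib

/-!
# Jets of a parametric integral of a compactly supported smooth family, their joint continuity in a topological parameter, and the curried
# `C_c^∞(M, P →ᵇ E)` packaging (Hörmander, *ALPDO I*, Thms. 1.1.6–1.1.9; Dieudonné (8.11.2))

Topic `Analysis/Calculus`; namespace `Literature.Analysis.Calculus`.  THEOREMS ONLY (no definition, no instance, no notation, no axiom, no named fact, no `sorry`).
Generic calculus∕measure theory over Mathlib + ★ `IteratedFDerivParametricIntegral` + ★ `ContDiffCurryCompact`.

THE SITUATION.  `A` a topological measurable space with a measure `μ` finite on compact sets, `M` a real normed space (the smooth slot), `E` a real Banach space, `P` a topological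
space (continuous parameters; compact when currying), and a family `H : P → A → M → E` such that every `H p a` is `C^∞`, the partial jets `(p, a, Y) ↦ Dⁿ_Y (H p a) Y` are JOINTLY
continuous, and the family is supported in ONE compact `C ⊆ A` and ONE compact `K ⊆ M`.  Then, with no countability or metrisability hypothesis on `P` or `A`:
* §1 (fixed `p`) the domination package of ★ `IteratedFDerivParametricIntegral` is DISCHARGED from compact support (bound = `sup` over `C × K`, majorant = an indicator;
  measurability by `Continuous.stronglyMeasurable_of_support_subset_isCompact`): `exists_integrable_forall_norm_iteratedFDeriv_le_of_support`; hence
  **`iteratedFDeriv_integral_eq_of_support`** (`Dⁿ_Y ∫ H a Y dμ = ∫ Dⁿ_Y (H a) Y dμ`) and **`contDiff_integral_of_support`** (`Y ↦ ∫ H a Y dμ` is `C^∞`).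
* §2 (with the parameter) **`continuous_iteratedFDeriv_integral_of_support`**: `(p, Y) ↦ Dⁿ_Y (∫ H p a · dμ) Y` is JOINTLY continuous (Mathlib `continuousOn_integral_of_compact_support`
  — uniform approximation on the compact `C`, no first countability).
* §3 (P compact) the CURRIED map `g : M → (P →ᵇ E)`, `g Y p = ∫ H p a Y dμ`, is `C^∞` with compact support and `evalCLM p (Dⁿ g Y v) = ∫ Dⁿ_Y (H p a) Y v dμ`
  (**`contDiff_curry_integral_of_support`**, **`hasCompactSupport_curry_integral_of_support`**, **`iteratedFDeriv_curry_integral_apply_of_support`**) — ★ (CURRY-∞) with its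
  hypotheses supplied by §1–§2.
* §4 (ED. 2, LOCAL twin on an OPEN set `U` of the smooth slot, `M` proper): `H a` only `C^∞ ON U`, jets jointly continuous on `A × U`, and the `A`-support compact only LOCALLY
  UNIFORMLY (near every `x₀ ∈ U` one compact `C` off which `H a` vanishes on a neighbourhood) ⇒ **`contDiffOn_integral_of_support_local`**, **`iteratedFDeriv_integral_eq_of_support_local`**,
  **`continuousOn_iteratedFDeriv_integral_of_support_local`** (★ `SmoothParametricIntegralDominated` with its local domination DISCHARGED) — the regular OPEN BOX `(ψ′, Y)` of the
  k-fold normalised orbital object, where the conjugating sets are compact only for `ψ′` off the walls (Schwarz commutation `D_Y ∂_{ψ′} = ∂_{ψ′} D_Y` then holds by joint smoothness).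
WHY (cell `pub/hodgecm-mathlib`, crux H413 `stmt-HodgeConjecture-24833`, line LH3, letter L3′ (α4) «all-orders transport», stage (α4-S6) «multi-wall base points», LH10-p01 (g4) census
`F0/P3c/LH10/LH10-p01/g4/s6/CENSUS-alpha4-S6.v1.md` brick (S6-B1)): in the induction step `Inv k → Inv (k+1)` the `(k)`-fold normalised orbital object, differentiated in the last
matrix variable `Y_k`, must be ONE smooth compactly supported `(P′ →ᵇ E)`-valued test function of `Y_k` (to feed ★ (α2) `…cayley_comp_clm_le`); this file is the generic half of that
packaging (the integral over the first `k` places with `Y_k` as the smooth slot and `(ψ′, p)` as continuous parameters).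
HONEST LABEL: HC_CM is proved only modulo the 7 printed citations (2 remaining: hLiu418 = `stmt-HodgeConjecture-24832`, h413 = `stmt-HodgeConjecture-24833`) until rung 0 closes;
pure calculus, count-neutral, pays nothing by itself.

## References
* [HormanderALPDO1] L. Hörmander, *The Analysis of Linear Partial Differential Operators I*, 2nd ed. (1990), §1.1 Thms. 1.1.6–1.1.9 (pp. 8–12).
* [Dieudonne1960] J. Dieudonné, *Foundations of Modern Analysis* (1960), (8.11.2).
-/

set_option autoImplicit false

noncomputable section

open MeasureTheory Set Filter Function Topology BoundedContinuousFunction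
open scoped ContDiff

namespace Literature.Analysis.Calculus

/-! ## §1 Fixed parameter: the domination package from compact support -/

section Fixed

variable {A : Type*} [TopologicalSpace A] [MeasurableSpace A] [OpensMeasurableSpace A] [T2Space A] {μ : Measure A} [IsFiniteMeasureOnCompacts μ]
  {M : Type*} [NormedAddCommGroup M] [NormedSpace ℝ M]
  {E : Type*} [NormedAddCommGroup E] [NormedSpace ℝ E]

omit [TopologicalSpace A] [MeasurableSpace A] [OpensMeasurableSpace A] [T2Space A] [IsFiniteMeasureOnCompacts μ] in
/-- The jets of a member of the family vanish off the `M`-support compact: `Y ∉ K`, `H a ≡ 0` off `K` ⇒ `Dⁿ (H a) Y = 0`. [cite: HormanderALPDO1, §1.1 Thm. 1.1.9 (p. 12)] -/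
theorem iteratedFDeriv_eq_zero_of_forall_notMem_eq_zero {f : M → E} {K : Set M} (hK : IsClosed K) (hf : ∀ Y ∉ K, f Y = 0) (n : ℕ) {Y : M} (hY : Y ∉ K) :
    iteratedFDeriv ℝ n f Y = 0 := by
  apply image_eq_zero_of_notMem_tsupport
  intro h
  exact hY (((tsupport_iteratedFDeriv_subset n).trans (closure_minimal (support_subset_iff'.2 hf) hK)) h)

omit [TopologicalSpace A] [MeasurableSpace A] [OpensMeasurableSpace A] [T2Space A] [IsFiniteMeasureOnCompacts μ] [NormedSpace ℝ E] in
/-- The jets of the zero member vanish: `H a ≡ 0` ⇒ `Dⁿ (H a) = 0`. [cite: HormanderALPDO1, §1.1 Thm. 1.1.9 (p. 12)] -/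
theorem iteratedFDeriv_eq_zero_of_forall_eq_zero [NormedSpace ℝ E] {f : M → E} (hf : ∀ Y, f Y = 0) (n : ℕ) (Y : M) : iteratedFDeriv ℝ n f Y = 0 := by
  have h : f = fun _ => (0 : E) := funext hf
  rw [h, iteratedFDeriv_fun_zero]
  rfl

/-- **Domination from compact support**: for a family `H : A → M → E` with jointly continuous jets supported in the compact `C × K`, every jet order has an integrable
majorant `g_n = (sup_{C × K} ‖Dⁿ‖) · 1_C` — hypothesis `h3` of ★ `iteratedFDeriv_integral_eq`. [cite: HormanderALPDO1, §1.1 Thm. 1.1.9 (p. 12)] [cite: Dieudonne1960, (8.11.2)] -/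
theorem exists_integrable_forall_norm_iteratedFDeriv_le_of_support {H : A → M → E}
    (hc : ∀ n : ℕ, Continuous (fun x : A × M => iteratedFDeriv ℝ n (H x.1) x.2))
    {C : Set A} (hC : IsCompact C) (hCz : ∀ a, a ∉ C → ∀ Y, H a Y = 0) {K : Set M} (hK : IsCompact K) (hKz : ∀ a, ∀ Y ∉ K, H a Y = 0) (n : ℕ) :
    ∃ g : A → ℝ, Integrable g μ ∧ ∀ a Y, ‖iteratedFDeriv ℝ n (H a) Y‖ ≤ g a := by
  obtain ⟨B, hB⟩ := (hC.prod hK).exists_bound_of_continuousOn (f := fun x : A × M => iteratedFDeriv ℝ n (H x.1) x.2) (hc n).continuousOn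
  refine ⟨C.indicator (fun _ => max B 0), ?_, fun a Y => ?_⟩
  · exact (integrable_indicator_iff hC.measurableSet).2 (integrableOn_const hC.measure_lt_top.ne)
  · by_cases ha : a ∈ C
    · rw [indicator_of_mem ha]
      by_cases hY : Y ∈ K
      · exact (hB (a, Y) ⟨ha, hY⟩).trans (le_max_left _ _)
      · rw [iteratedFDeriv_eq_zero_of_forall_notMem_eq_zero hK.isClosed (hKz a) n hY, norm_zero]
        exact le_max_right _ _
    · rw [indicator_of_notMem ha, iteratedFDeriv_eq_zero_of_forall_eq_zero (hCz a ha) n Y, norm_zero]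

omit [T2Space A] [IsFiniteMeasureOnCompacts μ] in
/-- Measurability of the jets in the integration variable, from continuity and compact support (`Continuous.stronglyMeasurable_of_support_subset_isCompact`; no second
countability) — hypothesis `h2` of ★ `iteratedFDeriv_integral_eq`. [cite: HormanderALPDO1, §1.1 Thm. 1.1.9 (p. 12)] -/
theorem aestronglyMeasurable_iteratedFDeriv_of_support {H : A → M → E}
    (hc : ∀ n : ℕ, Continuous (fun x : A × M => iteratedFDeriv ℝ n (H x.1) x.2))
    {C : Set A} (hC : IsCompact C) (hCz : ∀ a, a ∉ C → ∀ Y, H a Y = 0) (n : ℕ) (Y : M) :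
    AEStronglyMeasurable (fun a => iteratedFDeriv ℝ n (H a) Y) μ := by
  have hcont : Continuous fun a => iteratedFDeriv ℝ n (H a) Y := (hc n).comp (continuous_id.prodMk continuous_const)
  refine (hcont.stronglyMeasurable_of_support_subset_isCompact hC ?_).aestronglyMeasurable
  exact support_subset_iff'.2 fun a ha => iteratedFDeriv_eq_zero_of_forall_eq_zero (hCz a ha) n Y

variable [CompleteSpace E]

/-- **ITERATED DIFFERENTIATION UNDER THE INTEGRAL SIGN, compactly supported smooth family**: `Dⁿ_Y (∫ H a · dμ) Y = ∫ Dⁿ_Y (H a) Y dμ`.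
[cite: HormanderALPDO1, §1.1 Thm. 1.1.9 (p. 12)] [cite: Dieudonne1960, (8.11.2)] -/
theorem iteratedFDeriv_integral_eq_of_support {H : A → M → E} (hH : ∀ a, ContDiff ℝ ∞ (H a))
    (hc : ∀ n : ℕ, Continuous (fun x : A × M => iteratedFDeriv ℝ n (H x.1) x.2))
    {C : Set A} (hC : IsCompact C) (hCz : ∀ a, a ∉ C → ∀ Y, H a Y = 0) {K : Set M} (hK : IsCompact K) (hKz : ∀ a, ∀ Y ∉ K, H a Y = 0) (n : ℕ) (Y : M) :
    iteratedFDeriv ℝ n (fun Y => ∫ a, H a Y ∂μ) Y = ∫ a, iteratedFDeriv ℝ n (H a) Y ∂μ :=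
  iteratedFDeriv_integral_eq hH (fun n Y => aestronglyMeasurable_iteratedFDeriv_of_support hc hC hCz n Y)
    (fun n => exists_integrable_forall_norm_iteratedFDeriv_le_of_support hc hC hCz hK hKz n) n Y

/-- **SMOOTHNESS OF THE PARAMETRIC INTEGRAL, compactly supported smooth family**: `Y ↦ ∫ H a Y dμ` is `C^∞`. [cite: HormanderALPDO1, §1.1 Thm. 1.1.9 (p. 12)] [cite: Dieudonne1960, (8.11.2)] -/
theorem contDiff_integral_of_support {H : A → M → E} (hH : ∀ a, ContDiff ℝ ∞ (H a))
    (hc : ∀ n : ℕ, Continuous (fun x : A × M => iteratedFDeriv ℝ n (H x.1) x.2))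
    {C : Set A} (hC : IsCompact C) (hCz : ∀ a, a ∉ C → ∀ Y, H a Y = 0) {K : Set M} (hK : IsCompact K) (hKz : ∀ a, ∀ Y ∉ K, H a Y = 0) :
    ContDiff ℝ ∞ fun Y => ∫ a, H a Y ∂μ :=
  contDiff_integral_of_dominated_iteratedFDeriv hH (fun n Y => aestronglyMeasurable_iteratedFDeriv_of_support hc hC hCz n Y)
    (fun n => exists_integrable_forall_norm_iteratedFDeriv_le_of_support hc hC hCz hK hKz n)

end Fixed

/-! ## §2 With a topological parameter: joint continuity of the jets of the parametric integral -/

section Param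

variable {P : Type*} [TopologicalSpace P]
  {A : Type*} [TopologicalSpace A] [MeasurableSpace A] [OpensMeasurableSpace A] [T2Space A] {μ : Measure A} [IsFiniteMeasureOnCompacts μ]
  {M : Type*} [NormedAddCommGroup M] [NormedSpace ℝ M]
  {E : Type*} [NormedAddCommGroup E] [NormedSpace ℝ E] [CompleteSpace E]

/-- **JOINT CONTINUITY OF THE JETS OF A PARAMETRIC INTEGRAL** in a topological parameter `p` and the smooth variable `Y`: if the jets `(p, a, Y) ↦ Dⁿ_Y (H p a) Y` are jointly
continuous and the family is supported in `C × K` (compacts, uniformly in `p`), then `(p, Y) ↦ Dⁿ_Y (∫ H p a · dμ) Y` is continuous — §1 pointwise + Mathlib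
`continuousOn_integral_of_compact_support` (uniform approximation on `C`; NO countability on `P`). [cite: HormanderALPDO1, §1.1 Thms. 1.1.6, 1.1.9 (pp. 8–12)] -/
theorem continuous_iteratedFDeriv_integral_of_support {H : P → A → M → E} (hH : ∀ p a, ContDiff ℝ ∞ (H p a))
    (hc : ∀ n : ℕ, Continuous (fun x : P × A × M => iteratedFDeriv ℝ n (H x.1 x.2.1) x.2.2))
    {C : Set A} (hC : IsCompact C) (hCz : ∀ p a, a ∉ C → ∀ Y, H p a Y = 0) {K : Set M} (hK : IsCompact K) (hKz : ∀ p a, ∀ Y ∉ K, H p a Y = 0) (n : ℕ) :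
    Continuous fun x : P × M => iteratedFDeriv ℝ n (fun Y => ∫ a, H x.1 a Y ∂μ) x.2 := by
  have hcp : ∀ p, ∀ m : ℕ, Continuous (fun x : A × M => iteratedFDeriv ℝ m (H p x.1) x.2) := fun p m =>
    (hc m).comp (continuous_const.prodMk continuous_id)
  have heq : (fun x : P × M => iteratedFDeriv ℝ n (fun Y => ∫ a, H x.1 a Y ∂μ) x.2) = fun x : P × M => ∫ a, iteratedFDeriv ℝ n (H x.1 a) x.2 ∂μ :=
    funext fun x => iteratedFDeriv_integral_eq_of_support (hH x.1) (hcp x.1) hC (hCz x.1) hK (hKz x.1) n x.2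
  rw [heq, ← continuousOn_univ]
  refine continuousOn_integral_of_compact_support (f := fun (x : P × M) (a : A) => iteratedFDeriv ℝ n (H x.1 a) x.2) hC ?_ fun x a _ ha => ?_
  · exact ((hc n).comp ((continuous_fst.comp continuous_fst).prodMk (continuous_snd.prodMk (continuous_snd.comp continuous_fst)))).continuousOn
  · exact iteratedFDeriv_eq_zero_of_forall_eq_zero (hCz x.1 a ha) n x.2

omit [T2Space A] [NormedSpace ℝ M] [CompleteSpace E] in
/-- Order `0`: `(p, Y) ↦ ∫ H p a Y dμ` is jointly continuous (joint continuity of `(p, a, Y) ↦ H p a Y` + compact support in `a`). [cite: HormanderALPDO1, §1.1 Thm. 1.1.6 (p. 8)] -/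
theorem continuous_integral_of_support {H : P → A → M → E} (hc : Continuous (fun x : P × A × M => H x.1 x.2.1 x.2.2))
    {C : Set A} (hC : IsCompact C) (hCz : ∀ p a, a ∉ C → ∀ Y, H p a Y = 0) :
    Continuous fun x : P × M => ∫ a, H x.1 a x.2 ∂μ := by
  rw [← continuousOn_univ]
  refine continuousOn_integral_of_compact_support (f := fun (x : P × M) (a : A) => H x.1 a x.2) hC ?_ fun x a _ ha => hCz x.1 a ha x.2
  exact (hc.comp ((continuous_fst.comp continuous_fst).prodMk (continuous_snd.prodMk (continuous_snd.comp continuous_fst)))).continuousOn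

end Param

/-! ## §3 `P` compact: the curried `C_c^∞(M, P →ᵇ E)` packaging of the parametric integral -/

section Curry

variable {P : Type*} [TopologicalSpace P] [CompactSpace P]
  {A : Type*} [TopologicalSpace A] [MeasurableSpace A] [OpensMeasurableSpace A] [T2Space A] {μ : Measure A} [IsFiniteMeasureOnCompacts μ]
  {M : Type*} [NormedAddCommGroup M] [NormedSpace ℝ M]
  {E : Type*} [NormedAddCommGroup E] [NormedSpace ℝ E] [CompleteSpace E]

/-- **THE CURRIED PARAMETRIC INTEGRAL IS `C^∞` INTO `P →ᵇ E`**: `g : M → (P →ᵇ E)` with `g Y p = ∫ H p a Y dμ` is smooth (★ (CURRY-∞) `contDiff_curry_infty_of_forall_apply_eq`, its two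
hypotheses being §1 `contDiff_integral_of_support` and §2 `continuous_iteratedFDeriv_integral_of_support`). [cite: HormanderALPDO1, §1.1 Thms. 1.1.6–1.1.9 (pp. 8–12)] -/
theorem contDiff_curry_integral_of_support {H : P → A → M → E} (hH : ∀ p a, ContDiff ℝ ∞ (H p a))
    (hc : ∀ n : ℕ, Continuous (fun x : P × A × M => iteratedFDeriv ℝ n (H x.1 x.2.1) x.2.2))
    {C : Set A} (hC : IsCompact C) (hCz : ∀ p a, a ∉ C → ∀ Y, H p a Y = 0) {K : Set M} (hK : IsCompact K) (hKz : ∀ p a, ∀ Y ∉ K, H p a Y = 0)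
    {g : M → (P →ᵇ E)} (hg : ∀ Y p, g Y p = ∫ a, H p a Y ∂μ) : ContDiff ℝ ∞ g :=
  contDiff_curry_infty_of_forall_apply_eq (f := fun q : P × M => ∫ a, H q.1 a q.2 ∂μ) hg
    (fun p => contDiff_integral_of_support (hH p) (fun m => (hc m).comp (continuous_const.prodMk continuous_id)) hC (hCz p) hK (hKz p))
    (fun n => continuous_iteratedFDeriv_integral_of_support hH hc hC hCz hK hKz n)

omit [CompactSpace P] [TopologicalSpace A] [OpensMeasurableSpace A] [T2Space A] [IsFiniteMeasureOnCompacts μ] [NormedSpace ℝ M] [CompleteSpace E] in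
/-- **… with compact support** (`g Y = 0` for `Y ∉ K`). [cite: HormanderALPDO1, §1.1 Thm. 1.1.9 (p. 12)] -/
theorem hasCompactSupport_curry_integral_of_support {H : P → A → M → E}
    {K : Set M} (hK : IsCompact K) (hKz : ∀ p a, ∀ Y ∉ K, H p a Y = 0)
    {g : M → (P →ᵇ E)} (hg : ∀ Y p, g Y p = ∫ a, H p a Y ∂μ) : HasCompactSupport g :=
  hasCompactSupport_curry_of_forall_apply_eq (f := fun q : P × M => ∫ a, H q.1 a q.2 ∂μ) hg hK fun p Y hY => by
    show ∫ a, H p a Y ∂μ = 0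
    simp_rw [hKz p _ Y hY, integral_zero]

/-- **… and its jets, evaluated at `p`, are the integrals of the jets**: `Dⁿ g Y v p = ∫ Dⁿ_Y (H p a) Y v dμ` (★ jet formula of (CURRY-∞) + §1 + the evaluation CLM through the
Bochner integral). [cite: HormanderALPDO1, §1.1 Thms. 1.1.6, 1.1.9 (pp. 8–12)] -/
theorem iteratedFDeriv_curry_integral_apply_of_support {H : P → A → M → E} (hH : ∀ p a, ContDiff ℝ ∞ (H p a))
    (hc : ∀ n : ℕ, Continuous (fun x : P × A × M => iteratedFDeriv ℝ n (H x.1 x.2.1) x.2.2))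
    {C : Set A} (hC : IsCompact C) (hCz : ∀ p a, a ∉ C → ∀ Y, H p a Y = 0) {K : Set M} (hK : IsCompact K) (hKz : ∀ p a, ∀ Y ∉ K, H p a Y = 0)
    {g : M → (P →ᵇ E)} (hg : ∀ Y p, g Y p = ∫ a, H p a Y ∂μ) (n : ℕ) (Y : M) (v : Fin n → M) (p : P) :
    iteratedFDeriv ℝ n g Y v p = ∫ a, iteratedFDeriv ℝ n (H p a) Y v ∂μ := by
  have hcp : ∀ p, ∀ m : ℕ, Continuous (fun x : A × M => iteratedFDeriv ℝ m (H p x.1) x.2) := fun p m =>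
    (hc m).comp (continuous_const.prodMk continuous_id)
  rw [iteratedFDeriv_curry_apply_infty_of_forall_apply_eq (f := fun q : P × M => ∫ a, H q.1 a q.2 ∂μ) hg
      (fun p => contDiff_integral_of_support (hH p) (hcp p) hC (hCz p) hK (hKz p))
      (fun n => continuous_iteratedFDeriv_integral_of_support hH hc hC hCz hK hKz n) n Y v p]
  show iteratedFDeriv ℝ n (fun Y => ∫ a, H p a Y ∂μ) Y v = ∫ a, iteratedFDeriv ℝ n (H p a) Y v ∂μ
  rw [iteratedFDeriv_integral_eq_of_support (hH p) (hcp p) hC (hCz p) hK (hKz p) n Y]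
  -- evaluation at `v` is a continuous linear map and commutes with the Bochner integral
  have hint : Integrable (fun a => iteratedFDeriv ℝ n (H p a) Y) μ := by
    obtain ⟨gb, hgb, hle⟩ := exists_integrable_forall_norm_iteratedFDeriv_le_of_support (μ := μ) (hcp p) hC (hCz p) hK (hKz p) n
    exact Integrable.mono' hgb (aestronglyMeasurable_iteratedFDeriv_of_support (hcp p) hC (hCz p) n Y) (Eventually.of_forall fun a => hle a Y)
  exact ((ContinuousMultilinearMap.apply ℝ (fun _ : Fin n => M) E v).integral_comp_comm hint).symm

end Curry

/-! ## §4 (ED. 2) LOCAL twin: smooth slot restricted to an open set, integration support compact only locally uniformly -/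

section Local

variable {A : Type*} [TopologicalSpace A] [MeasurableSpace A] [OpensMeasurableSpace A] [T2Space A] {μ : Measure A} [IsFiniteMeasureOnCompacts μ]
  {M : Type*} [NormedAddCommGroup M] [NormedSpace ℝ M]
  {E : Type*} [NormedAddCommGroup E] [NormedSpace ℝ E]

omit [TopologicalSpace A] [MeasurableSpace A] [OpensMeasurableSpace A] [T2Space A] [IsFiniteMeasureOnCompacts μ] in
/-- Jets vanish at the points of an open set on which the function vanishes (locality of `iteratedFDeriv`, Mathlib `Filter.EventuallyEq.iteratedFDeriv`).
[cite: HormanderALPDO1, §1.1 Thm. 1.1.9 (p. 12)] -/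
theorem iteratedFDeriv_eq_zero_of_forall_mem_eq_zero {f : M → E} {V : Set M} (hV : IsOpen V) (hf : ∀ Y ∈ V, f Y = 0) (n : ℕ) {Y : M} (hY : Y ∈ V) :
    iteratedFDeriv ℝ n f Y = 0 := by
  have h : f =ᶠ[𝓝 Y] (fun _ => (0 : E)) := eventually_of_mem (hV.mem_nhds hY) hf
  rw [(h.iteratedFDeriv ℝ n).eq_of_nhds, iteratedFDeriv_fun_zero]
  rfl

/-- **LOCAL domination from locally uniform compact support** (`M` proper): near every `x₀ ∈ U` there are `ε > 0` and an integrable majorant of `‖Dⁿ_Y (H a) Y‖` for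
`Y ∈ B(x₀, ε)` — the `hdom` of ★ `contDiffOn_integral_of_dominated`. [cite: HormanderALPDO1, §1.1 Thm. 1.1.9 (p. 12)] [cite: Dieudonne1960, (8.11.2)] -/
theorem exists_integrable_forall_norm_iteratedFDeriv_le_of_support_local [ProperSpace M] {H : A → M → E} {U : Set M}
    (hc : ∀ n : ℕ, ContinuousOn (fun x : A × M => iteratedFDeriv ℝ n (H x.1) x.2) (univ ×ˢ U))
    (hloc : ∀ x₀ ∈ U, ∃ V : Set M, IsOpen V ∧ x₀ ∈ V ∧ V ⊆ U ∧ ∃ C : Set A, IsCompact C ∧ ∀ a, a ∉ C → ∀ Y ∈ V, H a Y = 0)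
    (n : ℕ) {x₀ : M} (hx₀ : x₀ ∈ U) :
    ∃ ε > 0, ∃ g : A → ℝ, Integrable g μ ∧ ∀ a, ∀ Y ∈ Metric.ball x₀ ε, ‖iteratedFDeriv ℝ n (H a) Y‖ ≤ g a := by
  obtain ⟨V, hVo, hxV, hVU, C, hC, hCz⟩ := hloc x₀ hx₀
  obtain ⟨ε, hε, hball⟩ := Metric.isOpen_iff.1 hVo x₀ hxV
  have hsub : Metric.closedBall x₀ (ε / 2) ⊆ V := (Metric.closedBall_subset_ball (half_lt_self hε)).trans hball
  obtain ⟨B, hB⟩ := (hC.prod (isCompact_closedBall x₀ (ε / 2))).exists_bound_of_continuousOn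
    ((hc n).mono (prod_mono (subset_univ _) (hsub.trans hVU)))
  refine ⟨ε / 2, half_pos hε, C.indicator (fun _ => max B 0), (integrable_indicator_iff hC.measurableSet).2 (integrableOn_const hC.measure_lt_top.ne),
    fun a Y hY => ?_⟩
  by_cases ha : a ∈ C
  · rw [indicator_of_mem ha]
    exact (hB (a, Y) ⟨ha, Metric.ball_subset_closedBall hY⟩).trans (le_max_left _ _)
  · rw [indicator_of_notMem ha, iteratedFDeriv_eq_zero_of_forall_mem_eq_zero hVo (hCz a ha) n
      (hball (Metric.ball_subset_ball (half_le_self hε.le) hY)), norm_zero]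

omit [T2Space A] [IsFiniteMeasureOnCompacts μ] in
/-- Measurability of the jets in the integration variable at a point of `U` (continuity + compact support; no countability) — the `hmeas` of ★ `contDiffOn_integral_of_dominated`.
[cite: HormanderALPDO1, §1.1 Thm. 1.1.9 (p. 12)] -/
theorem aestronglyMeasurable_iteratedFDeriv_of_support_local {H : A → M → E} {U : Set M}
    (hc : ∀ n : ℕ, ContinuousOn (fun x : A × M => iteratedFDeriv ℝ n (H x.1) x.2) (univ ×ˢ U))
    (hloc : ∀ x₀ ∈ U, ∃ V : Set M, IsOpen V ∧ x₀ ∈ V ∧ V ⊆ U ∧ ∃ C : Set A, IsCompact C ∧ ∀ a, a ∉ C → ∀ Y ∈ V, H a Y = 0)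
    (n : ℕ) {Y : M} (hY : Y ∈ U) :
    AEStronglyMeasurable (fun a => iteratedFDeriv ℝ n (H a) Y) μ := by
  obtain ⟨V, hVo, hYV, -, C, hC, hCz⟩ := hloc Y hY
  have hcont : Continuous fun a => iteratedFDeriv ℝ n (H a) Y :=
    (hc n).comp_continuous (continuous_id.prodMk continuous_const) fun a => ⟨mem_univ _, hY⟩
  refine (hcont.stronglyMeasurable_of_support_subset_isCompact hC ?_).aestronglyMeasurable
  exact support_subset_iff'.2 fun a ha => iteratedFDeriv_eq_zero_of_forall_mem_eq_zero hVo (hCz a ha) n hYV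

/-- **SMOOTHNESS ON AN OPEN SET OF THE SMOOTH SLOT**, integration support compact only locally uniformly: `Y ↦ ∫ H a Y dμ` is `C^∞` on `U`
(★ `contDiffOn_integral_of_dominated`, its `hmeas`∕`hdom` discharged). [cite: HormanderALPDO1, §1.1 Thm. 1.1.9 (p. 12)] [cite: Dieudonne1960, (8.11.2)] -/
theorem contDiffOn_integral_of_support_local [ProperSpace M] {H : A → M → E} {U : Set M} (hU : IsOpen U)
    (hH : ∀ a, ContDiffOn ℝ ∞ (H a) U)
    (hc : ∀ n : ℕ, ContinuousOn (fun x : A × M => iteratedFDeriv ℝ n (H x.1) x.2) (univ ×ˢ U))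
    (hloc : ∀ x₀ ∈ U, ∃ V : Set M, IsOpen V ∧ x₀ ∈ V ∧ V ⊆ U ∧ ∃ C : Set A, IsCompact C ∧ ∀ a, a ∉ C → ∀ Y ∈ V, H a Y = 0) :
    ContDiffOn ℝ ∞ (fun Y => ∫ a, H a Y ∂μ) U :=
  Literature.Analysis.FunctionSpaces.contDiffOn_integral_of_dominated (f := fun Y a => H a Y) hU (Eventually.of_forall hH)
    (fun m Y hY => aestronglyMeasurable_iteratedFDeriv_of_support_local hc hloc m hY)
    (fun m x₀ hx₀ => by
      obtain ⟨ε, hε, g, hg, hle⟩ := exists_integrable_forall_norm_iteratedFDeriv_le_of_support_local (μ := μ) hc hloc m hx₀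
      exact ⟨ε, hε, g, hg, Eventually.of_forall fun a Y hY => hle a Y hY⟩)

/-- **JETS UNDER THE INTEGRAL SIGN ON AN OPEN SET OF THE SMOOTH SLOT**: `Dⁿ_Y (∫ H a · dμ) Y = ∫ Dⁿ_Y (H a) Y dμ` for `Y ∈ U`.
[cite: HormanderALPDO1, §1.1 Thm. 1.1.9 (p. 12)] [cite: Dieudonne1960, (8.11.2)] -/
theorem iteratedFDeriv_integral_eq_of_support_local [ProperSpace M] {H : A → M → E} {U : Set M} (hU : IsOpen U)
    (hH : ∀ a, ContDiffOn ℝ ∞ (H a) U)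
    (hc : ∀ n : ℕ, ContinuousOn (fun x : A × M => iteratedFDeriv ℝ n (H x.1) x.2) (univ ×ˢ U))
    (hloc : ∀ x₀ ∈ U, ∃ V : Set M, IsOpen V ∧ x₀ ∈ V ∧ V ⊆ U ∧ ∃ C : Set A, IsCompact C ∧ ∀ a, a ∉ C → ∀ Y ∈ V, H a Y = 0)
    (n : ℕ) {Y : M} (hY : Y ∈ U) :
    iteratedFDeriv ℝ n (fun Y => ∫ a, H a Y ∂μ) Y = ∫ a, iteratedFDeriv ℝ n (H a) Y ∂μ :=
  Literature.Analysis.FunctionSpaces.iteratedFDeriv_integral_of_dominated (f := fun Y a => H a Y) hU (Eventually.of_forall hH)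
    (fun m Y hY => aestronglyMeasurable_iteratedFDeriv_of_support_local hc hloc m hY)
    (fun m x₀ hx₀ => by
      obtain ⟨ε, hε, g, hg, hle⟩ := exists_integrable_forall_norm_iteratedFDeriv_le_of_support_local (μ := μ) hc hloc m hx₀
      exact ⟨ε, hε, g, hg, Eventually.of_forall fun a Y hY => hle a Y hY⟩) n hY

/-- **JOINT CONTINUITY OF THE JETS ON AN OPEN SET, WITH A TOPOLOGICAL PARAMETER**: jets of `(p, a, Y) ↦ H p a Y` jointly continuous on `P × A × U` and, near every `(p₀, x₀)`,
ONE compact `C ⊆ A` off which the members vanish on a neighbourhood ⇒ `(p, Y) ↦ Dⁿ_Y (∫ H p a · dμ) Y` is continuous on `P × U` (Mathlib `continuousOn_integral_of_compact_support`,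
no countability on `P`). [cite: HormanderALPDO1, §1.1 Thms. 1.1.6, 1.1.9 (pp. 8–12)] -/
theorem continuousOn_iteratedFDeriv_integral_of_support_local [ProperSpace M] {P : Type*} [TopologicalSpace P] {H : P → A → M → E} {U : Set M} (hU : IsOpen U)
    (hH : ∀ p a, ContDiffOn ℝ ∞ (H p a) U)
    (hc : ∀ n : ℕ, ContinuousOn (fun x : P × A × M => iteratedFDeriv ℝ n (H x.1 x.2.1) x.2.2) (univ ×ˢ univ ×ˢ U))
    (hloc : ∀ (p₀ : P), ∀ x₀ ∈ U, ∃ W : Set P, IsOpen W ∧ p₀ ∈ W ∧ ∃ V : Set M, IsOpen V ∧ x₀ ∈ V ∧ V ⊆ U ∧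
      ∃ C : Set A, IsCompact C ∧ ∀ p ∈ W, ∀ a, a ∉ C → ∀ Y ∈ V, H p a Y = 0) (n : ℕ) :
    ContinuousOn (fun x : P × M => iteratedFDeriv ℝ n (fun Y => ∫ a, H x.1 a Y ∂μ) x.2) (univ ×ˢ U) := by
  have hcp : ∀ p, ∀ m : ℕ, ContinuousOn (fun x : A × M => iteratedFDeriv ℝ m (H p x.1) x.2) (univ ×ˢ U) := fun p m =>
    (hc m).comp (continuous_const.prodMk continuous_id).continuousOn fun x hx => ⟨mem_univ _, mem_univ _, hx.2⟩
  have hlocp : ∀ p, ∀ x₀ ∈ U, ∃ V : Set M, IsOpen V ∧ x₀ ∈ V ∧ V ⊆ U ∧ ∃ C : Set A, IsCompact C ∧ ∀ a, a ∉ C → ∀ Y ∈ V, H p a Y = 0 := by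
    intro p x₀ hx₀
    obtain ⟨W, -, hpW, V, hVo, hxV, hVU, C, hC, hCz⟩ := hloc p x₀ hx₀
    exact ⟨V, hVo, hxV, hVU, C, hC, fun a ha Y hY => hCz p hpW a ha Y hY⟩
  rintro ⟨p₀, x₀⟩ ⟨-, hx₀⟩
  obtain ⟨W, hWo, hpW, V, hVo, hxV, hVU, C, hC, hCz⟩ := hloc p₀ x₀ hx₀
  have key : ContinuousOn (fun x : P × M => ∫ a, iteratedFDeriv ℝ n (H x.1 a) x.2 ∂μ) (W ×ˢ V) := by
    refine continuousOn_integral_of_compact_support (f := fun (x : P × M) (a : A) => iteratedFDeriv ℝ n (H x.1 a) x.2) hC ?_ fun x a hx ha => ?_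
    · exact (hc n).comp ((continuous_fst.comp continuous_fst).prodMk (continuous_snd.prodMk (continuous_snd.comp continuous_fst))).continuousOn
        fun q hq => ⟨mem_univ _, mem_univ _, hVU hq.1.2⟩
    · exact iteratedFDeriv_eq_zero_of_forall_mem_eq_zero hVo (hCz x.1 hx.1 a ha) n hx.2
  have hnhds : W ×ˢ V ∈ 𝓝 (p₀, x₀) := (hWo.prod hVo).mem_nhds ⟨hpW, hxV⟩
  have heq : (fun x : P × M => ∫ a, iteratedFDeriv ℝ n (H x.1 a) x.2 ∂μ) =ᶠ[𝓝 (p₀, x₀)]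
      fun x : P × M => iteratedFDeriv ℝ n (fun Y => ∫ a, H x.1 a Y ∂μ) x.2 :=
    eventually_of_mem hnhds fun x hx => (iteratedFDeriv_integral_eq_of_support_local hU (hH x.1) (hcp x.1) (hlocp x.1) n (hVU hx.2)).symm
  exact ((key.continuousAt hnhds).congr heq).continuousWithinAt

end Local

end Literature.Analysis.Calculus

end
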